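import Summits.BirchSwinnertonDyer.BirchSwinnertonDyer.Theorems.SchneiderFreeAdditiveX3AnomalousTwistLambdaLE
import Summits.BirchSwinnertonDyer.BirchSwinnertonDyer.Theorems.EisensteinPrimesSplitMultSfTransfer
import HarnessLib

/-!
# Route `SchneiderFreeAdditiveX3` (K1 door), crux r3 `GordTwoBranchIMC` (stmt-BirchSwinnertonDyer-19177): Keller–Yin's anomalous
# λ-inequality for the ANOMALOUS `(−3)`-TWIST in the DOOR's currency — `Sf` the places over `N_W` OFF `3`

Cell `bsd-schneider-ideate`, seat `bsd-schneider-door-c5` (prover, generation 31; assembly layer; `--supports` 19177, helper).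
PARTITION: board row B6 ∩ X3 ∩ sst-twist, `r = 1` — the 1 725 ANOMALOUS pairs of the (G-ord, `e = 2`) half at `p = 3` (of 2 411).
bears_on: K1-door (items 18971/18972 retired → 19177 r3).  FILE 7 of the port of cell `bsd-eis`'s V21 INDEX ROAD to the door's ANOMALOUS
TWIN (FINDING-door-c5-g28 §5b `stub_λW`) = the door analogue of x2-p2 g10's `SplitMultLambdaLEOffP`: FILE 6's
`AnomalousTwistLambdaLE.lambdaInvariant_add_le_of_anomalousTwist` is stated over x1's `Sf` («`w ∈ Sf ↔ N_W ∈ w`», containing `v`, `v̄` since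
`9 ∣ N_W`); the door's files (generations 24–28: `KYLambdaAlg*`, `AnomalousTwistMuZero*`) use the `3`-FREE set «`w ∈ Sf ↔ (N_W ∈ w ∧ 3 ∉ w)`»
(Keller–Yin §1 `S = Σ ∖ {v, v̄, ∞}`).  The two sets agree off `3` and no Selmer condition of the road reads `S` above `3`, so every object
transfers by x2's reduction-free `SplitMultSfTransfer.{selmerAc_congr_offP, xAc_invariants_congr, prop_datumDualData_congr_offP}` BY NAME; the
only new input is `3 ∣ N_W` (`Addv W 3`, `dvd_conductorNorm_iff_not_hasGoodReductionAtPrime`).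

`lambdaInvariant_add_le_of_anomalousTwist_offP`: `W = C • V^{(p*)}`, `p = 3`, `V` globally minimal good ordinary with `3 ∣ a₃(V) − 1`, `W`
globally minimal ADDITIVE at `3`; `K` imaginary quadratic with (Heeg) for `N_W` and `3 = v v̄`; `W(K)[3] = 0`; `κ` anticyclotomic with generator
`γ`; `(θsub, θquot)` a residual pair of `W_K[3]` with `θsub` non-trivial on `D_v̄`; Fin_v `hfinED`; `Sf` the `3`-free places over `N_W`; dual data,
cotorsion clauses; GRANTED the six named PUB facts: `λ(DSsub.X) + λ(DSquot.X) ≤ λ(𝔛^{Sf}(W_K)) + [θquot = 𝟙]`.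

HONEST FRAMING: composition theorem CONDITIONAL BY NAME on six published facts typed as `Prop`s; the cotorsion clauses and Fin_v are HYPOTHESES;
nothing analytic; no registered stub closed; no item closed; BSD proved for no curve; «closes rung: none».  References: Keller–Yin
arXiv:2402.12781v2 Thm. 1.4.1 (iii), §1, §5.1 [KellerYin2024]; [Castella2018] Def. 2.2; [Greenberg2016Selmer] Prop. 2.6.3; [Greenberg2006] Props.
3.2, 4.1, 4.2, §5 A; [NeukirchSchmidtWingberg2008] (8.3.18); x2 `SplitMultLambdaLEOffP` (template).
-/

set_option autoImplicit false
-- the route's Theorems namespace repeats the summit name by design (D-0017 nested layout)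
set_option linter.dupNamespace false

noncomputable section

open scoped Classical

namespace Summit.BirchSwinnertonDyer.BirchSwinnertonDyer.Theorems.SchneiderFreeAdditiveX3.AnomalousTwistLambdaLEOffP

open PowerSeries WeierstrassCurve NumberField IsDedekindDomain Field
  Literature.NumberTheory.GaloisRepresentations Literature.NumberTheory.EllipticCurves.GreenbergVatsal2000
  Literature.NumberTheory.EllipticCurves Literature.NumberTheory.EllipticCurves.Rank1Residual
  Literature.NumberTheory.EllipticCurves.Castella2018 Literature.NumberTheory.EllipticCurves.GreenbergSelmer
  Literature.NumberTheory.QuadraticFields Literature.NumberTheory.EllipticCurves.KellerYin2024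
  Literature.NumberTheory.EllipticCurves.IwasawaAlgebra Literature.NumberTheory.IwasawaTheory
  Literature.NumberTheory.IwasawaTheory.Greenberg2016 Literature.NumberTheory.IwasawaTheory.Greenberg2006
  Literature.NumberTheory.GaloisCohomology
  Summit.BirchSwinnertonDyer.Rank1Residual.X2.ResidualDevissageModules
  Summit.BirchSwinnertonDyer.BirchSwinnertonDyer.Theorems
  Summit.BirchSwinnertonDyer.BirchSwinnertonDyer.Theorems.SplitMultSfTransfer
  Summit.BirchSwinnertonDyer.BirchSwinnertonDyer.Theorems.SchneiderFreeAdditiveX3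

/-- `3 ∣ N_W` at an ADDITIVE prime, read as `N_W ∈ w` for every place `w ∋ 3` of `K`. [cite: SilvermanAEC2009, VII.§5 and VIII.§1] -/
theorem conductorNorm_mem_of_natCast_mem_of_addv {K : Type} [Field K] [NumberField K] (W : WeierstrassCurve ℚ) [W.IsElliptic]
    [W.IsGloballyMinimal] {p : ℕ} [Fact p.Prime] (haddv : Addv W p)
    {w : HeightOneSpectrum (𝓞 K)} (hw : ((p : ℕ) : 𝓞 K) ∈ w.asIdeal) :
    ((W.conductorNorm ℤ : ℤ) : 𝓞 K) ∈ w.asIdeal := by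
  obtain ⟨m, hm⟩ := (W.dvd_conductorNorm_iff_not_hasGoodReductionAtPrime p).mpr haddv.1
  rw [hm, Nat.cast_mul, Int.cast_mul, Int.cast_natCast]
  exact w.asIdeal.mul_mem_right _ hw

/-- **Keller–Yin's anomalous `λ`-inequality (Thm. 1.4.1 (iii), `≤` half) FOR THE ANOMALOUS `(−3)`-TWIST IN THE DOOR's CURRENCY** (`Sf` the
`3`-free places over `N_W`): as FILE 6's `lambdaInvariant_add_le_of_anomalousTwist`, with every object over `Sf`; proof = run the `Sf ∪ {v, v̄}`
statement and transfer by x2's `SplitMultSfTransfer` (the two sets agree off `3`).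
[cite: KellerYin2024, Thm. 1.4.1 (iii), §1.3–§1.4 Cases I–III, §1 (S = Σ ∖ {v, v̄, ∞}) (arXiv:2402.12781v2)] [cite: Castella2018, Def. 2.2]
[cite: Greenberg2016Selmer, Prop. 2.6.3] [cite: Greenberg2006, Props. 3.2, 4.1, 4.2, §5 A] [cite: NeukirchSchmidtWingberg2008, (8.3.18)] -/
theorem lambdaInvariant_add_le_of_anomalousTwist_offP {V : WeierstrassCurve ℚ} [V.IsElliptic] [V.IsGloballyMinimal]
    (h263 : prop263_sur_of_crk) (h41 : prop41_globalEulerPoincareCorank)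
    (h42 : prop42_localEulerPoincareCorank) (h5A : sec5A_localH2_subsingleton_of_LOC1)
    (h32 : prop32_cohomology_isCofinitelyGenerated)
    (W : WeierstrassCurve ℚ) [W.IsElliptic] [W.IsGloballyMinimal] (p : ℕ) [Fact p.Prime]
    (hp3 : p = 3) (hV : GoodOrd V p) (ha : (p : ℤ) ∣ V.frobeniusTrace p - 1)
    (C : VariableChange ℚ) (hC : C • V.quadraticTwist ((-1 : ℚ) ^ (p / 2) * p) = W) (haddv : Addv W p)
    (K : Type) [Field K] [NumberField K] (hK : IsImaginaryQuadratic K)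
    (hCD2 : groupCdLE_two_galoisGroupUnramifiedOutside K)
    (hH : SatisfiesHeegnerHypothesis (W.conductorNorm ℤ) K)
    (htor : ∀ Q : (W.baseChange K).toAffine.Point, p • Q = 0 → Q = 0)
    (ι : K →+* ℚ_[p]) (v vbar : HeightOneSpectrum (𝓞 K))
    (hv : ∀ x : 𝓞 K, x ∈ v.asIdeal ↔ ‖ι (x : K)‖ < 1)
    (hvbar : ((p : ℕ) : 𝓞 K) ∈ vbar.asIdeal) (hne : vbar ≠ v)
    (κ : ZpExtension K p) (hκ : κ.IsAnticyclotomic)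
    (γ : absoluteGaloisGroup K) [Fact (κ.IsTopGenerator γ)]
    (θsub θquot : FramedGaloisRep K (padicCoeffIntegers (∅ : Set (PadicAlgCl p))) 1)
    (hpair : IsResidualPairOver (W.baseChange K) p θsub θquot)
    (hram : ∃ τ ∈ decomp vbar, unitChar θsub τ ≠ 1)
    (hfinED : Finite {x : ↥((W.baseChange K).geomPrimaryTorsion p) // ∀ g : ↥(κ.kerSubgroup ⊓ decomp vbar), g • x = x})
    (Sf : Finset (HeightOneSpectrum (𝓞 K)))
    (hSf : ∀ w : HeightOneSpectrum (𝓞 K), w ∈ Sf ↔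
      (((W.conductorNorm ℤ : ℤ) : 𝓞 K) ∈ w.asIdeal ∧ ((p : ℕ) : 𝓞 K) ∉ w.asIdeal))
    (DSsub : DatumDualData κ γ (charModule ∅ θsub)
        (AcSelmer.bdpData (charModule ∅ θsub) p vbar) (↑Sf : Set (HeightOneSpectrum (𝓞 K))))
    (DSquot : DatumDualData κ γ (charModule ∅ θquot)
        (AcSelmer.bdpData (charModule ∅ θquot) p vbar) (↑Sf : Set (HeightOneSpectrum (𝓞 K))))
    (hfgS : Module.Finite (IwasawaAlgebra p) (AcSelmer.XAc (W.baseChange K) p κ vbar (↑Sf : Set (HeightOneSpectrum (𝓞 K))) γ))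
    (htorS : Module.IsTorsion (IwasawaAlgebra p) (AcSelmer.XAc (W.baseChange K) p κ vbar (↑Sf : Set (HeightOneSpectrum (𝓞 K))) γ))
    (hμS : muInvariant p (AcSelmer.XAc (W.baseChange K) p κ vbar (↑Sf : Set (HeightOneSpectrum (𝓞 K))) γ) = 0)
    (hSsub : ∀ D : DatumDualData κ γ (charModule ∅ θsub)
        (AcSelmer.bdpData (charModule ∅ θsub) p vbar) (↑Sf : Set (HeightOneSpectrum (𝓞 K))),
      Module.Finite (IwasawaAlgebra p) D.X ∧ Module.IsTorsion (IwasawaAlgebra p) D.X ∧ muInvariant p D.X = 0)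
    (hSquot : ∀ D : DatumDualData κ γ (charModule ∅ θquot)
        (AcSelmer.bdpData (charModule ∅ θquot) p vbar) (↑Sf : Set (HeightOneSpectrum (𝓞 K))),
      Module.Finite (IwasawaAlgebra p) D.X ∧ Module.IsTorsion (IwasawaAlgebra p) D.X ∧ muInvariant p D.X = 0) :
    lambdaInvariant p DSsub.X + lambdaInvariant p DSquot.X ≤
      lambdaInvariant p (AcSelmer.XAc (W.baseChange K) p κ vbar (↑Sf : Set (HeightOneSpectrum (𝓞 K))) γ) +
        (if ∀ σ : absoluteGaloisGroup K, θquot σ = 1 then 1 else 0) := by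
  have hpv : ((p : ℕ) : 𝓞 K) ∈ v.asIdeal := IndexPlumbingNrVsStrict.natCast_mem_asIdeal_of_forall_norm_iff hv
  -- the x1-convention set `SN = Sf ∪ {v, v̄}` and its agreement with `Sf` off `p`
  set SN : Finset (HeightOneSpectrum (𝓞 K)) := insert v (insert vbar Sf) with hSNdef
  have hSp : ∀ w : HeightOneSpectrum (𝓞 K), ((p : ℕ) : 𝓞 K) ∈ w.asIdeal →
      w ∈ (↑(insert v (insert vbar Sf)) : Set (HeightOneSpectrum (𝓞 K))) :=
    AcTwistDeformationResidualPair.mem_insert_insert_of_natCast_mem hK hpv hvbar hne Sf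
  have hSN : ∀ w : HeightOneSpectrum (𝓞 K), w ∈ SN ↔ ((W.conductorNorm ℤ : ℤ) : 𝓞 K) ∈ w.asIdeal := by
    intro w
    constructor
    · intro hw
      rw [hSNdef, Finset.mem_insert, Finset.mem_insert] at hw
      rcases hw with rfl | rfl | hw
      · exact conductorNorm_mem_of_natCast_mem_of_addv W haddv hpv
      · exact conductorNorm_mem_of_natCast_mem_of_addv W haddv hvbar
      · exact ((hSf w).mp hw).1
    · intro hN
      by_cases hpw : ((p : ℕ) : 𝓞 K) ∈ w.asIdeal
      · have h := hSp w hpw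
        rw [Finset.mem_coe] at h
        rw [hSNdef]; exact h
      · rw [hSNdef, Finset.mem_insert, Finset.mem_insert]
        exact Or.inr (Or.inr ((hSf w).mpr ⟨hN, hpw⟩))
  have hoff : ∀ w : HeightOneSpectrum (𝓞 K), ((p : ℕ) : 𝓞 K) ∉ w.asIdeal →
      (w ∈ (↑Sf : Set (HeightOneSpectrum (𝓞 K))) ↔ w ∈ (↑SN : Set (HeightOneSpectrum (𝓞 K)))) := by
    intro w hpw
    rw [Finset.mem_coe, Finset.mem_coe, hSNdef, Finset.mem_insert, Finset.mem_insert]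
    constructor
    · exact fun hw ↦ Or.inr (Or.inr hw)
    · rintro (rfl | rfl | hw)
      · exact absurd hpv hpw
      · exact absurd hvbar hpw
      · exact hw
  have hoff' : ∀ w : HeightOneSpectrum (𝓞 K), ((p : ℕ) : 𝓞 K) ∉ w.asIdeal →
      (w ∈ (↑SN : Set (HeightOneSpectrum (𝓞 K))) ↔ w ∈ (↑Sf : Set (HeightOneSpectrum (𝓞 K)))) :=
    fun w hpw ↦ (hoff w hpw).symm
  -- transfer of the curve-side invariants `Sf → SN`
  haveI hEK : (W.baseChange K).IsElliptic := inferInstanceAs (W.map (algebraMap ℚ K)).IsElliptic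
  have hsel : AcSelmer.selmerAc (W.baseChange K) p κ vbar (↑Sf : Set (HeightOneSpectrum (𝓞 K))) =
      AcSelmer.selmerAc (W.baseChange K) p κ vbar (↑SN : Set (HeightOneSpectrum (𝓞 K))) :=
    selmerAc_congr_offP κ (W.baseChange K) vbar hoff
  obtain ⟨hfgT, htorT, hμT, hlamT⟩ := xAc_invariants_congr (W.baseChange K) p κ vbar γ hsel
  have hfgS' := hfgT hfgS
  have htorS' := htorT htorS
  have hμS' : muInvariant p (AcSelmer.XAc (W.baseChange K) p κ vbar (↑SN : Set (HeightOneSpectrum (𝓞 K))) γ) = 0 := by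
    rw [← hμT]; exact hμS
  -- transfer of the character-side `∀ D` clauses `Sf → SN`
  have hSsub' : ∀ D : DatumDualData κ γ (charModule ∅ θsub)
      (AcSelmer.bdpData (charModule ∅ θsub) p vbar) (↑SN : Set (HeightOneSpectrum (𝓞 K))),
      Module.Finite (IwasawaAlgebra p) D.X ∧ Module.IsTorsion (IwasawaAlgebra p) D.X ∧ muInvariant p D.X = 0 := fun D ↦
    prop_datumDualData_congr_offP κ (AcSelmer.bdpData (charModule ∅ θsub) p vbar) hoff'
      (fun X _ _ ↦ Module.Finite (IwasawaAlgebra p) X ∧ Module.IsTorsion (IwasawaAlgebra p) X ∧ muInvariant p X = 0) hSsub D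
  have hSquot' : ∀ D : DatumDualData κ γ (charModule ∅ θquot)
      (AcSelmer.bdpData (charModule ∅ θquot) p vbar) (↑SN : Set (HeightOneSpectrum (𝓞 K))),
      Module.Finite (IwasawaAlgebra p) D.X ∧ Module.IsTorsion (IwasawaAlgebra p) D.X ∧ muInvariant p D.X = 0 := fun D ↦
    prop_datumDualData_congr_offP κ (AcSelmer.bdpData (charModule ∅ θquot) p vbar) hoff'
      (fun X _ _ ↦ Module.Finite (IwasawaAlgebra p) X ∧ Module.IsTorsion (IwasawaAlgebra p) X ∧ muInvariant p X = 0) hSquot D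
  -- the `SN`-statement for every pair of `SN`-dual data
  have hmain : ∀ (D₁ : DatumDualData κ γ (charModule ∅ θsub)
        (AcSelmer.bdpData (charModule ∅ θsub) p vbar) (↑SN : Set (HeightOneSpectrum (𝓞 K))))
      (D₃ : DatumDualData κ γ (charModule ∅ θquot)
        (AcSelmer.bdpData (charModule ∅ θquot) p vbar) (↑SN : Set (HeightOneSpectrum (𝓞 K)))),
      lambdaInvariant p D₁.X + lambdaInvariant p D₃.X ≤
        lambdaInvariant p (AcSelmer.XAc (W.baseChange K) p κ vbar (↑Sf : Set (HeightOneSpectrum (𝓞 K))) γ) +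
          (if ∀ σ : absoluteGaloisGroup K, θquot σ = 1 then 1 else 0) := by
    intro D₁ D₃
    rw [hlamT]
    exact AnomalousTwistLambdaLE.lambdaInvariant_add_le_of_anomalousTwist h263 h41 h42 h5A h32 W p hp3 hV ha C hC K hK hCD2 hH htor ι
      v vbar hv hvbar hne κ hκ γ θsub θquot hpair hram hfinED SN hSN D₁ D₃ hfgS' htorS' hμS' hSsub' hSquot'
  -- transfer of the conclusion `SN → Sf` (twice)
  exact prop_datumDualData_congr_offP κ (AcSelmer.bdpData (charModule ∅ θsub) p vbar) hoff
    (fun X _ _ ↦ lambdaInvariant p X + lambdaInvariant p DSquot.X ≤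
      lambdaInvariant p (AcSelmer.XAc (W.baseChange K) p κ vbar (↑Sf : Set (HeightOneSpectrum (𝓞 K))) γ) +
        (if ∀ σ : absoluteGaloisGroup K, θquot σ = 1 then 1 else 0))
    (fun D₁ ↦ prop_datumDualData_congr_offP κ (AcSelmer.bdpData (charModule ∅ θquot) p vbar) hoff
      (fun Y _ _ ↦ lambdaInvariant p D₁.X + lambdaInvariant p Y ≤
        lambdaInvariant p (AcSelmer.XAc (W.baseChange K) p κ vbar (↑Sf : Set (HeightOneSpectrum (𝓞 K))) γ) +
          (if ∀ σ : absoluteGaloisGroup K, θquot σ = 1 then 1 else 0))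
      (fun D₃ ↦ hmain D₁ D₃) DSquot) DSsub

end Summit.BirchSwinnertonDyer.BirchSwinnertonDyer.Theorems.SchneiderFreeAdditiveX3.AnomalousTwistLambdaLEOffP

end
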